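import Mathlib

/-!
# Solo-blind: simultaneous mid-gap selection for finitely many ladders (paper §24.45, (H9″)/(Q))

On a dead lobe the well spectrum near `s = 0` is a union of finitely many Bohr–Sommerfeld LADDERS,
one per closed loop `Λ_k` of the leaf symbol (paper §24.43–24.45): locally each ladder is an arithmetic
progression `a k + m • d k` (`m ∈ ℤ`) of spacing `d k > 0`.  The construction needs ONE value of the
free parameter in a window `[0, X]` that is at distance `≥ r k` from EVERY rung of EVERY ladder
simultaneously.  If `∑ k, ((X + 2 r k) / d k + 1) * (2 r k) < X` such a value exists: the rungs of
ladder `k` that come within `r k` of the window are indexed by the integers of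
`[⌈(-r k - a k)/d k⌉, ⌊(X + r k - a k)/d k⌋]`, at most `(X + 2 r k)/d k + 1` of them, each excluding an
interval of length `2 r k`, and the excluded set has Lebesgue measure `< X = |[0, X]|`.  This is the
many-ladder, comparable-spacing replacement of the two-family NESTED mid-gap lemma
(kernel `SoloBlindNestedMidgap`, which needs separated scales).

* `card_int_Icc_ceil_floor_le` — `#(Finset.Icc ⌈lo⌉ ⌊hi⌋) ≤ hi - lo + 1` when `lo ≤ hi + 1`.
* `simultaneous_midgap` — the statement above.
* `simultaneous_midgap_of_small_radii` — the usable form: radii `r k ≤ d k / (8 L)` (`L` ladders,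
  `d k ≤ X`) are always admissible; the loss `8 L` is polynomial in the number of loops.
-/

namespace Summit.AnomalousDissipation.AnomalousDissipation.Theorems

open MeasureTheory Set

/-- Integers in a real interval: `#(Finset.Icc ⌈lo⌉ ⌊hi⌋) ≤ hi - lo + 1` (given `lo ≤ hi + 1`, which
makes the right-hand side nonnegative). -/
theorem card_int_Icc_ceil_floor_le (lo hi : ℝ) (h : lo ≤ hi + 1) :
    ((Finset.Icc ⌈lo⌉ ⌊hi⌋).card : ℝ) ≤ hi - lo + 1 := by
  rw [Int.card_Icc]
  have hf : (⌊hi⌋ : ℝ) ≤ hi := Int.floor_le hi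
  have hc : lo ≤ (⌈lo⌉ : ℝ) := Int.le_ceil lo
  by_cases hle : ⌈lo⌉ ≤ ⌊hi⌋ + 1
  · have h1 : (((⌊hi⌋ + 1 - ⌈lo⌉).toNat : ℤ)) = ⌊hi⌋ + 1 - ⌈lo⌉ := Int.toNat_of_nonneg (by omega)
    have h2 : (((⌊hi⌋ + 1 - ⌈lo⌉).toNat : ℕ) : ℝ) = (⌊hi⌋ : ℝ) + 1 - (⌈lo⌉ : ℝ) := by
      have h3 := congrArg (fun z : ℤ => (z : ℝ)) h1
      push_cast at h3
      exact h3
    rw [h2]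
    linarith
  · have h0 : (⌊hi⌋ + 1 - ⌈lo⌉).toNat = 0 := Int.toNat_eq_zero.mpr (by omega)
    rw [h0]
    push_cast
    linarith

/-- **Simultaneous mid-gap.**  Finitely many ladders `a k + m • d k` (`m ∈ ℤ`, spacings `d k > 0`) with
exclusion radii `r k ≥ 0` on a window `[0, X]`, `X > 0`; if `∑ k, ((X + 2 r k)/d k + 1) * (2 r k) < X`
then some point of `[0, X]` is at distance at least `r k` from every rung of every ladder. -/
theorem simultaneous_midgap {ι : Type*} [Fintype ι] (a d r : ι → ℝ) (X : ℝ) (hX : 0 < X)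
    (hd : ∀ k, 0 < d k) (hr : ∀ k, 0 ≤ r k)
    (hsum : ∑ k, ((X + 2 * r k) / d k + 1) * (2 * r k) < X) :
    ∃ x ∈ Set.Icc (0 : ℝ) X, ∀ k, ∀ m : ℤ, r k ≤ |x - (a k + m * d k)| := by
  classical
  -- rungs of ladder k that matter, and the excluded set
  set M : ι → Finset ℤ := fun k => Finset.Icc ⌈(-r k - a k) / d k⌉ ⌊(X + r k - a k) / d k⌋ with hM
  set U : Set ℝ := ⋃ k, ⋃ m ∈ M k, Ioo (a k + (m : ℝ) * d k - r k) (a k + (m : ℝ) * d k + r k) with hU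
  -- cardinality of M k
  have hcard : ∀ k, ((M k).card : ℝ) ≤ (X + 2 * r k) / d k + 1 := by
    intro k
    have hdk := hd k
    have hlohi : (-r k - a k) / d k ≤ (X + r k - a k) / d k + 1 := by
      have : (-r k - a k) / d k ≤ (X + r k - a k) / d k :=
        div_le_div_of_nonneg_right (by linarith [hr k]) hdk.le
      linarith
    have := card_int_Icc_ceil_floor_le ((-r k - a k) / d k) ((X + r k - a k) / d k) hlohi
    have heq : (X + r k - a k) / d k - (-r k - a k) / d k = (X + 2 * r k) / d k := by
      field_simp
      ring
    rw [heq] at this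
    simpa only [hM] using this
  -- measure of U
  have hvolU : volume U ≤ ENNReal.ofReal (∑ k, ((M k).card : ℝ) * (2 * r k)) := by
    calc volume U ≤ ∑' k, volume (⋃ m ∈ M k, Ioo (a k + (m : ℝ) * d k - r k) (a k + (m : ℝ) * d k + r k)) :=
          measure_iUnion_le _
      _ = ∑ k, volume (⋃ m ∈ M k, Ioo (a k + (m : ℝ) * d k - r k) (a k + (m : ℝ) * d k + r k)) :=
          tsum_fintype _
      _ ≤ ∑ k, ∑ m ∈ M k, volume (Ioo (a k + (m : ℝ) * d k - r k) (a k + (m : ℝ) * d k + r k)) :=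
          Finset.sum_le_sum (fun k _ => measure_biUnion_finset_le _ _)
      _ = ∑ k, ∑ m ∈ M k, ENNReal.ofReal (2 * r k) := by
          refine Finset.sum_congr rfl (fun k _ => Finset.sum_congr rfl (fun m _ => ?_))
          rw [Real.volume_Ioo]
          congr 1
          ring
      _ = ∑ k, ENNReal.ofReal (((M k).card : ℝ) * (2 * r k)) := by
          refine Finset.sum_congr rfl (fun k _ => ?_)
          rw [Finset.sum_const, nsmul_eq_mul]
          symm
          rw [ENNReal.ofReal_mul (by positivity), ENNReal.ofReal_natCast]
      _ = ENNReal.ofReal (∑ k, ((M k).card : ℝ) * (2 * r k)) := by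
          rw [ENNReal.ofReal_sum_of_nonneg]
          intro k _
          exact mul_nonneg (by positivity) (by linarith [hr k])
  -- the total excluded length is < X
  have hS : ∑ k, ((M k).card : ℝ) * (2 * r k) < X := by
    have : ∑ k, ((M k).card : ℝ) * (2 * r k) ≤ ∑ k, ((X + 2 * r k) / d k + 1) * (2 * r k) :=
      Finset.sum_le_sum (fun k _ => mul_le_mul_of_nonneg_right (hcard k) (by linarith [hr k]))
    linarith
  have hS0 : 0 ≤ ∑ k, ((M k).card : ℝ) * (2 * r k) :=
    Finset.sum_nonneg (fun k _ => mul_nonneg (by positivity) (by linarith [hr k]))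
  -- hence the window is not covered
  have hnot : ¬ (Set.Icc (0 : ℝ) X ⊆ U) := by
    intro hsub
    have h1 : volume (Set.Icc (0 : ℝ) X) ≤ volume U := measure_mono hsub
    rw [Real.volume_Icc, sub_zero] at h1
    have h2 : ENNReal.ofReal X ≤ ENNReal.ofReal (∑ k, ((M k).card : ℝ) * (2 * r k)) := h1.trans hvolU
    rw [ENNReal.ofReal_le_ofReal_iff hS0] at h2
    linarith
  obtain ⟨x, hx, hxU⟩ := Set.not_subset.mp hnot
  refine ⟨x, hx, fun k m => ?_⟩
  by_contra hlt
  rw [not_le] at hlt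
  apply hxU
  -- x is within r k of the rung m of ladder k; that rung is one of the counted ones
  have hdk := hd k
  rw [abs_lt] at hlt
  obtain ⟨h1, h2⟩ := hlt
  have hx0 : 0 ≤ x := hx.1
  have hx1 : x ≤ X := hx.2
  have hmM : m ∈ M k := by
    rw [hM, Finset.mem_Icc]
    constructor
    · -- ⌈(-r-a)/d⌉ ≤ m  ⇔ (-r-a)/d ≤ m
      rw [Int.ceil_le, div_le_iff₀ hdk]
      nlinarith
    · rw [Int.le_floor, le_div_iff₀ hdk]
      nlinarith
  rw [hU, Set.mem_iUnion]
  refine ⟨k, ?_⟩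
  rw [Set.mem_iUnion₂]
  exact ⟨m, hmM, by constructor <;> linarith⟩

/-- The usable form: with `L` ladders of spacings `d k ≤ X`, the radii `r k ≤ d k / (8 L)` are always
admissible — every window `[0, X]` contains a point at distance `≥ r k` from every rung of every ladder.
(The loss is the factor `8 L`, polynomial in the number of loops.) -/
theorem simultaneous_midgap_of_small_radii {ι : Type*} [Fintype ι] (a d r : ι → ℝ) (X : ℝ)
    (hX : 0 < X) (hL : 0 < Fintype.card ι) (hd : ∀ k, 0 < d k) (hdX : ∀ k, d k ≤ X)
    (hr : ∀ k, 0 ≤ r k) (hrd : ∀ k, r k ≤ d k / (8 * Fintype.card ι)) :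
    ∃ x ∈ Set.Icc (0 : ℝ) X, ∀ k, ∀ m : ℤ, r k ≤ |x - (a k + m * d k)| := by
  apply simultaneous_midgap a d r X hX hd hr
  set L : ℝ := (Fintype.card ι : ℝ) with hLdef
  have hLpos : 0 < L := by rw [hLdef]; exact_mod_cast hL
  have hL1 : 1 ≤ L := by rw [hLdef]; exact_mod_cast hL
  have hterm : ∀ k, ((X + 2 * r k) / d k + 1) * (2 * r k) ≤ 3 * X / (4 * L) := by
    intro k
    have hdk := hd k
    have hrk := hr k
    have hrdk : r k ≤ d k / (8 * L) := hrd k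
    have h2r : 2 * r k ≤ d k / (4 * L) := by
      have : d k / (8 * L) * 2 = d k / (4 * L) := by field_simp; ring
      nlinarith
    have h2r1 : 2 * r k ≤ d k := by
      have : d k / (4 * L) ≤ d k := by
        rw [div_le_iff₀ (by positivity)]
        nlinarith
      linarith
    -- first factor ≤ X / d k + 2
    have hf1 : (X + 2 * r k) / d k + 1 ≤ X / d k + 2 := by
      rw [add_div]
      have : 2 * r k / d k ≤ 1 := by rw [div_le_one hdk]; exact h2r1
      linarith
    have hf1pos : 0 ≤ (X + 2 * r k) / d k + 1 := by positivity
    calc ((X + 2 * r k) / d k + 1) * (2 * r k)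
        ≤ (X / d k + 2) * (d k / (4 * L)) :=
          mul_le_mul hf1 h2r (by linarith) (by positivity)
      _ = X / (4 * L) + d k / (2 * L) := by field_simp; ring
      _ ≤ X / (4 * L) + X / (2 * L) := by
          have : d k / (2 * L) ≤ X / (2 * L) := div_le_div_of_nonneg_right (hdX k) (by positivity)
          linarith
      _ = 3 * X / (4 * L) := by field_simp; ring
  calc ∑ k, ((X + 2 * r k) / d k + 1) * (2 * r k)
      ≤ ∑ _k : ι, 3 * X / (4 * L) := Finset.sum_le_sum (fun k _ => hterm k)
    _ = L * (3 * X / (4 * L)) := by rw [Finset.sum_const, nsmul_eq_mul, Finset.card_univ]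
    _ = 3 * X / 4 := by field_simp
    _ < X := by linarith

end Summit.AnomalousDissipation.AnomalousDissipation.Theorems
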